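import Summits.Ventures.QEC.Census.CertChunks2F
import Summits.Ventures.QEC.Census.BB.BB144.BZAut4Data
import HarnessLib

/-!
# `BB144` — `bz_aut` data `bzAut4Data` (certA 27af9174ef991c5e, 4-block orbit cover, qec-search-10), side Z, block 0, matrix 1
# (depth 5): KERNEL enumeration, part q4/16 (re-plan ≤ 700000 codewords per theorem; emit_std_enum2.py)

Fast-shape chunk theorems (`chunk1RF` level-1 ranges, `chunk2RF` level-2 ranges for the heavy first rows; qec-type-08's
`CertCheckBZFast` scan + unrolled `wtGt11U`, qec-search-10's `CertChunks2F` twins), each ONE `decide +kernel` under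
`maxHeartbeats 400000000`; bridged to type-10's words by `chunk1RF_eq`/`chunk2RF_eq`/`bzTestZW_eq`. Tier KERNEL-std.
The matrix verdict is assembled in `BZAut4EnumZb0m1.lean`.
-/

namespace Summit.Ventures.QEC.Census.BB144

set_option maxHeartbeats 400000000 in
/-- Block 0, matrix 1, first row 6, second rows 0 … 36 after it (budget 3; 698708 codewords): pass (fast scan, kernel). -/
theorem enum4Z_0_1_r6_s0 : chunk2RF (BB144.cert.bzTestZW wtGt11U) (BB144.cert.bzPosZ BB144.bzAut4Data 0 1) 3 6 0 37 = true := by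
  decide +kernel

set_option maxHeartbeats 400000000 in
/-- Block 0, matrix 1, first row 6, second rows 37 … 64 after it (budget 3; 24157 codewords): pass (fast scan, kernel). -/
theorem enum4Z_0_1_r6_s37 : chunk2RF (BB144.cert.bzTestZW wtGt11U) (BB144.cert.bzPosZ BB144.bzAut4Data 0 1) 3 6 37 28 = true := by
  decide +kernel

end Summit.Ventures.QEC.Census.BB144
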